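import Mathlib
import Summits.Ventures.PercRepro.TriangleCapOneBelowLocusPieces

/-!
# PercRepro — THE EQUALITY LOCUS ONE BELOW THE DIAGONAL AT SECOND ORDER, THE WITHIN-ROW CASES: a vertex of degree
`a − 1` (strictly below for `k ≥ 2a + 3`; at `k = 2a + 2`, `D − z = K_{a,a+1}` with the neighbours of `z` on the
large side) and a vertex of degree `a` (`D − z` extremal at `(k − 1, a, 1)` with the neighbours on the large side,
or at the second-best value there — the locus at `k − 1` as the induction hypothesis, the neighbours of `z` on the
`(a + 1)`-side, the hung `K_{5,5}` at `k = 12` excluded by degrees) (p3, gen 44; part 197g)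

Axioms: standard.
-/

namespace PercRepro

namespace TriangleCap

namespace C047

open Finset

variable {V : Type*} [Fintype V] [DecidableEq V]

/-- The equality one below, read on the other bipartition `(k, a + 1, k − 2a)`:
`(k − 2) + 2 (k − 2a − 1)(a − 1) = (k − 2a)(k − 1 − (k − 2a))` for `1 ≤ a`, `2a + 2 ≤ k`. -/
theorem one_other_term (a k : ℕ) (ha : 1 ≤ a) (hk : 2 * a + 2 ≤ k) :
    (k - 2) + 2 * (k - 2 * a - 1) * (a - 1) = (k - 2 * a) * (k - 1 - (k - 2 * a)) := by
  obtain ⟨a', rfl⟩ : ∃ a', a = a' + 1 := ⟨a - 1, by omega⟩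
  obtain ⟨c, rfl⟩ : ∃ c, k = 2 * (a' + 1) + 2 + c := ⟨k - (2 * (a' + 1) + 2), by omega⟩
  have e1 : 2 * (a' + 1) + 2 + c - 2 = 2 * a' + 2 + c := by omega
  have e2 : 2 * (a' + 1) + 2 + c - 2 * (a' + 1) - 1 = c + 1 := by omega
  have e3 : a' + 1 - 1 = a' := by omega
  have e4 : 2 * (a' + 1) + 2 + c - 2 * (a' + 1) = c + 2 := by omega
  have e5 : 2 * (a' + 1) + 2 + c - 1 - (c + 2) = 2 * a' + 1 := by omega
  rw [e1, e2, e3, e4, e5]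
  ring

/-- The edge counts of `D − z` for a vertex of degree `d` on the cell `(k, a, 1)`: `m' + d + 1 = a (k − a)`;
for `d = a`: `m' + 1 = a (k − 1 − a)`, and at `k = 2a + 3`: `m' + 2 = (a + 1)((k − 1) − (a + 1))`. -/
theorem one_within_edges (a k m m' : ℕ) (ha : 1 ≤ a) (hk : 2 * a + 2 ≤ k) (hed : m' + a = m)
    (hm : m + 1 = a * (k - a)) :
    m' + 1 = a * (k - 1 - a) ∧ (k = 2 * a + 3 → m' + 2 = (a + 1) * (k - 1 - (a + 1))) := by
  have hmk : a * (k - a) = a * (k - 1 - a) + a := by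
    rw [← Nat.mul_succ]
    congr 1
    omega
  refine ⟨by omega, fun hk3 => ?_⟩
  subst hk3
  have e1 : 2 * a + 3 - 1 - a = a + 2 := by omega
  have e2 : 2 * a + 3 - 1 - (a + 1) = a + 1 := by omega
  rw [e1] at hmk
  rw [e2]
  nlinarith [hmk, hm, hed]

/-- The edge count of `D − z` for a vertex of degree `a − 1` on the cell `(k, a, 1)`: `m' = a (k − 1 − a)`
(`k = 2a + 2 + c`). -/
theorem one_within_minus_edges (a c m m' : ℕ) (ha : 1 ≤ a) (hed : m' + (a - 1) = m)
    (hm : m + 1 = a * (a + 2 + c)) : m' = a * (a + 1 + c) := by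
  obtain ⟨a', rfl⟩ : ∃ a', a = a' + 1 := ⟨a - 1, by omega⟩
  have e : a' + 1 - 1 = a' := by omega
  rw [e] at hed
  nlinarith [hed, hm]

/-- `D − z` at the first-order equality of the cell `(k − 1, a, 1)` is `a`-bipartite (`2a + 1 ≤ k − 1`,
`8 ≤ k − 1`). -/
theorem one_within_first_order (D : SimpleGraph V) [DecidableRel D.Adj] (hK : K4mFree D) (a : ℕ) (ha : 4 ≤ a)
    (z : V) (hk'' : 2 * a + 1 ≤ Fintype.card {v : V // v ≠ z})
    (hm'' : (del D z).edgeFinset.card + a * a + 1 = a * Fintype.card {v : V // v ≠ z})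
    (hS'eq : ∑ w : {v : V // v ≠ z}, deg (del D z) w * deg (del D z) w + (Fintype.card {v : V // v ≠ z} - 1 - 1) =
      (del D z).edgeFinset.card * Fintype.card {v : V // v ≠ z}) :
    ∃ A' : Finset {v : V // v ≠ z}, A'.card = a ∧ BipSub (del D z) A' := by
  have hK' := k4mFree_del D hK z
  obtain ⟨A', -, hA'card, hA', -⟩ := (closed_form_eq_iff (del D z) hK' a 1 (by omega) hk'' (by omega) hm'').mp
    (by rw [one_mul]; exact hS'eq)
  exact ⟨A', hA'card, hA'⟩

/-- The structure of the gap case one below for `k ≥ 2a + 3`: `D − z ⊆ K(A'', A''ᶜ)` with `|A''| = a + 1` (the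
locus at `k − 1`), the neighbours of `z` at degree `a + c = k − a − 2` ⇒ `D` is `(a + 1)`-bipartite. -/
theorem one_within_structure (D : SimpleGraph V) [DecidableRel D.Adj] (hK : K4mFree D) (a c : ℕ) (ha : 4 ≤ a)
    (hc : 1 ≤ c) (z : V) (hz : deg D z = a) (hk'' : Fintype.card {v : V // v ≠ z} = 2 * a + 1 + c)
    (A'' : Finset {v : V // v ≠ z}) (hA''card : A''.card = a + 1) (hA'' : BipSub (del D z) A'')
    (hdeg : ∀ w : {v : V // v ≠ z}, D.Adj w.1 z → deg (del D z) w = a + c) :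
    ∃ A : Finset V, A.card = a + 1 ∧ BipSub D A := by
  rcases Nat.lt_or_ge 1 c with hc2 | hc1'
  · have hin : ∀ w : {v : V // v ≠ z}, D.Adj w.1 z → w ∈ A'' := by
      intro w hw
      by_contra hwA
      have h1 := deg_le_card_of_bipSub (del D z) A'' hA'' w hwA
      have h2 := hdeg w hw
      omega
    obtain ⟨B, hBcard, hB⟩ := bipSub_lift D z A'' hA'' hin
    exact ⟨B, by rw [hBcard, hA''card], hB⟩
  · have hc1'' : c = 1 := by omega
    subst hc1''
    have hfull : ∀ w : {v : V // v ≠ z}, D.Adj w.1 z →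
        ∀ u : {v : V // v ≠ z}, (w ∈ A'' ↔ u ∉ A'') → (del D z).Adj w u := by
      intro w hw u hu
      by_cases hwA : w ∈ A''
      · have huA : u ∈ A''ᶜ := mem_compl.mpr (hu.mp hwA)
        exact adj_of_deg_eq_card_of_bipSub (del D z) A''ᶜ (bipSub_compl (del D z) A'' hA'') w
          (by rw [mem_compl, not_not]; exact hwA) (by rw [hdeg w hw, card_compl, hA''card, hk'']; omega) u huA
      · have huA : u ∈ A'' := by tauto
        exact adj_of_deg_eq_card_of_bipSub (del D z) A'' hA'' w hwA (by rw [hdeg w hw, hA''card]) u huA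
    rcases nbhd_one_side_of_full D hK z A'' hfull (by omega) with hin | hoff
    · obtain ⟨B, hBcard, hB⟩ := bipSub_lift D z A'' hA'' hin
      exact ⟨B, by rw [hBcard, hA''card], hB⟩
    · have hA''c : BipSub (del D z) A''ᶜ := bipSub_compl (del D z) A'' hA''
      obtain ⟨B, hBcard, hB⟩ := bipSub_lift D z A''ᶜ hA''c (fun w hw => mem_compl.mpr (hoff w hw))
      refine ⟨B, ?_, hB⟩
      rw [hBcard, card_compl, hA''card, hk'']
      omega

/-- `m' + 1 = a (a + 1 + c)` ⇒ `m' + a² + 1 = a (2a + 1 + c)`. -/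
theorem one_within_a_edges (a c m' : ℕ) (hm1 : m' + 1 = a * (a + 1 + c)) :
    m' + a * a + 1 = a * (2 * a + 1 + c) := by
  nlinarith [hm1]

/-- **THE WITHIN-ROW CASE AT EQUALITY ONE BELOW, `d = a − 1`:** onto the diagonal `(k − 1, a, 0)`: strictly below
for `k ≥ 2a + 3`, and at `k = 2a + 2` `D − z = K_{a,a+1}` with the neighbours of `z` on the large side. -/
theorem one_within_eq_minus (D : SimpleGraph V) [DecidableRel D.Adj] (hK : K4mFree D) (a : ℕ) (ha : 4 ≤ a)
    (hk : 2 * a + 2 ≤ Fintype.card V) (hm : D.edgeFinset.card + 1 = a * (Fintype.card V - a))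
    (hcap : ∀ v, deg D v + a + 1 ≤ Fintype.card V) (z : V) (hz : deg D z + 1 = a)
    (hne : ∑ v, deg D v * deg D v + (Fintype.card V - 2) ≠ D.edgeFinset.card * Fintype.card V)
    (heq : ∑ v, deg D v * deg D v + (Fintype.card V - 2) + 2 * (Fintype.card V - 2 * a - 1) * (a - 1) =
      D.edgeFinset.card * Fintype.card V) :
    ∃ A : Finset V, A.card = a + 1 ∧ BipSub D A := by
  have hK' := k4mFree_del D hK z
  have hcard' := card_del z
  have hedges' := card_edges_del D z
  have hsq := sum_deg_sq_del D z
  have hT := sum_del_nbhd_le D z (Fintype.card V - a - 2) (fun v => by have := hcap v; omega)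
  obtain ⟨d, hd⟩ : ∃ d, deg D z = d := ⟨_, rfl⟩
  rw [hd] at hz hedges' hsq hT
  obtain ⟨k, hk'⟩ : ∃ k, Fintype.card V = k := ⟨_, rfl⟩
  have hk'' : Fintype.card {v : V // v ≠ z} = k - 1 := by omega
  rw [hk'] at hk hm heq hT hne
  -- `D` is not `a`-bipartite: an `a`-bipartite graph with one missing pair is extremal
  have hnb : ¬ ∃ A : Finset V, A.card = a ∧ BipSub D A := by
    rintro ⟨A, hAcard, hA⟩
    apply hne
    have := sum_deg_sq_eq_of_bipSub_one D A a hAcard hA (by rw [hk']; exact hm) (by omega)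
    rw [hk'] at this
    exact this
  obtain ⟨T, hTdef⟩ : ∃ T, ∑ w : {v : V // v ≠ z}, (if D.Adj w.1 z then deg (del D z) w else 0) = T := ⟨_, rfl⟩
  obtain ⟨S', hS'def⟩ : ∃ S', ∑ w : {v : V // v ≠ z}, deg (del D z) w * deg (del D z) w = S' := ⟨_, rfl⟩
  obtain ⟨m', hm'def⟩ : ∃ m', (del D z).edgeFinset.card = m' := ⟨_, rfl⟩
  rw [hTdef, hS'def] at hsq
  rw [hTdef] at hT
  rw [hm'def] at hedges'
  obtain ⟨c, hc⟩ : ∃ c, k = 2 * a + 2 + c := ⟨k - (2 * a + 2), by omega⟩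
  subst hc
  have e2 : 2 * a + 2 + c - 1 = 2 * a + 1 + c := by omega
  have e3 : 2 * a + 2 + c - a - 2 = a + c := by omega
  have e4 : 2 * a + 2 + c - 2 * a - 1 = c + 1 := by omega
  have e5 : 2 * a + 2 + c - 2 = 2 * a + c := by omega
  have e6 : 2 * a + 2 + c - a = a + 2 + c := by omega
  rw [e2] at hk''
  rw [e3] at hT
  rw [e4, e5, hsq, ← hedges'] at heq
  rw [e6] at hm
  have hda1 : d < a := by omega
-- `d = a − 1`: onto the diagonal `(k − 1, a, 0)`
  have hda : d = a - 1 := by omega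
  subst hda
  have hm1 : m' = a * (a + 1 + c) := one_within_minus_edges a c D.edgeFinset.card m' (by omega) hedges' hm
  have hm'0 : (del D z).edgeFinset.card = a * (Fintype.card {v : V // v ≠ z} - a) := by
    rw [hm'def, hk'']
    have e : 2 * a + 1 + c - a = a + 1 + c := by omega
    rw [e]
    exact hm1
  -- `D − z` is `a`-bipartite: at once, or through the envelope at `k = 2a + 2`
  have hbipz : ∃ A' : Finset {v : V // v ≠ z}, A'.card = a ∧ BipSub (del D z) A' := by
    rcases diag_second_order_gen (del D z) hK' a ha (by rw [hk'']; omega) hm'0 with h | hgap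
    · exact h
    · rw [hS'def, hm'def, hk''] at hgap
      have e7 : 2 * a + 1 + c - 2 * a - 1 = c := by omega
      rw [e7] at hgap
      obtain ⟨hc0, hS'eq⟩ := one_within_minus a c m' S' T (by omega) (by rw [hedges']; exact hm) hgap hT heq
      subst hc0
      simp only [add_zero] at hS'eq hk'' hm1
      have hm'' : (del D z).edgeFinset.card + a * a + 0 = a * Fintype.card {v : V // v ≠ z} := by
        rw [hm'def, hk'', hm1]
        ring
      obtain ⟨A', -, hA'card, hA', -⟩ := (closed_form_eq_iff (del D z) hK' a 0 (by omega) (by omega) (by omega)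
        hm'').mp (by
          rw [hS'def, hm'def, hk'']
          simp only [zero_mul, add_zero]
          rw [hS'eq])
      exact ⟨A', hA'card, hA'⟩
  obtain ⟨A', hA'card, hA'⟩ := hbipz
  -- `D − z = K_{a,k−1−a}`: the `a − 1 ≥ 3` neighbours of `z` lie on one side
  rcases nbhd_one_side_of_bipSub D hK z A' a 0 hA'card hA' (by rw [add_zero]; exact hm'0) (by omega)
    with hin | hoff
  · exfalso
    obtain ⟨B, hBcard, hB⟩ := bipSub_lift D z A' hA' hin
    exact hnb ⟨B, by rw [hBcard, hA'card], hB⟩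
  · obtain ⟨A, hAcard, hA⟩ := bipSub_insert_of_nbhd_off D z A' hA' hoff
    exact ⟨A, by rw [hAcard, hA'card], hA⟩

/-- **THE WITHIN-ROW CASE AT EQUALITY ONE BELOW, `d = a`:** onto the cell `(k − 1, a, 1)`, with the locus at
`k − 1` as the induction hypothesis. -/
theorem one_within_eq_a (D : SimpleGraph V) [DecidableRel D.Adj] (hK : K4mFree D) (a : ℕ) (ha : 4 ≤ a)
    (hk : 2 * a + 2 ≤ Fintype.card V) (hm : D.edgeFinset.card + 1 = a * (Fintype.card V - a))
    (hcap : ∀ v, deg D v + a + 1 ≤ Fintype.card V) (z : V) (hz : deg D z = a)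
    (hne : ∑ v, deg D v * deg D v + (Fintype.card V - 2) ≠ D.edgeFinset.card * Fintype.card V)
    (heq : ∑ v, deg D v * deg D v + (Fintype.card V - 2) + 2 * (Fintype.card V - 2 * a - 1) * (a - 1) =
      D.edgeFinset.card * Fintype.card V)
    (hIH : 2 * a + 2 ≤ Fintype.card {v : V // v ≠ z} →
      ∑ w : {v : V // v ≠ z}, deg (del D z) w * deg (del D z) w + (Fintype.card {v : V // v ≠ z} - 2) ≠
        (del D z).edgeFinset.card * Fintype.card {v : V // v ≠ z} →
      ∑ w : {v : V // v ≠ z}, deg (del D z) w * deg (del D z) w + (Fintype.card {v : V // v ≠ z} - 2) +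
        2 * (Fintype.card {v : V // v ≠ z} - 2 * a - 1) * (a - 1) =
        (del D z).edgeFinset.card * Fintype.card {v : V // v ≠ z} →
      (∃ (A'' : Finset {v : V // v ≠ z}) (v : {v : V // v ≠ z}), A''.card = a + 1 ∧ BipSub (del D z) A'' ∧
        MissingStar (del D z) A'' v) ∨ (a = 4 ∧ Fintype.card {v : V // v ≠ z} = 11 ∧ HungK55 (del D z))) :
    ∃ A : Finset V, A.card = a + 1 ∧ BipSub D A := by
  have hK' := k4mFree_del D hK z
  have hcard' := card_del z
  have hedges' := card_edges_del D z
  have hsq := sum_deg_sq_del D z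
  have hT := sum_del_nbhd_le D z (Fintype.card V - a - 2) (fun v => by have := hcap v; omega)
  obtain ⟨d, hd⟩ : ∃ d, deg D z = d := ⟨_, rfl⟩
  rw [hd] at hz hedges' hsq hT
  obtain ⟨k, hk'⟩ : ∃ k, Fintype.card V = k := ⟨_, rfl⟩
  have hk'' : Fintype.card {v : V // v ≠ z} = k - 1 := by omega
  rw [hk'] at hk hm heq hT hne
  -- `D` is not `a`-bipartite: an `a`-bipartite graph with one missing pair is extremal
  have hnb : ¬ ∃ A : Finset V, A.card = a ∧ BipSub D A := by
    rintro ⟨A, hAcard, hA⟩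
    apply hne
    have := sum_deg_sq_eq_of_bipSub_one D A a hAcard hA (by rw [hk']; exact hm) (by omega)
    rw [hk'] at this
    exact this
  obtain ⟨T, hTdef⟩ : ∃ T, ∑ w : {v : V // v ≠ z}, (if D.Adj w.1 z then deg (del D z) w else 0) = T := ⟨_, rfl⟩
  obtain ⟨S', hS'def⟩ : ∃ S', ∑ w : {v : V // v ≠ z}, deg (del D z) w * deg (del D z) w = S' := ⟨_, rfl⟩
  obtain ⟨m', hm'def⟩ : ∃ m', (del D z).edgeFinset.card = m' := ⟨_, rfl⟩
  rw [hTdef, hS'def] at hsq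
  rw [hTdef] at hT
  rw [hm'def] at hedges'
  obtain ⟨c, hc⟩ : ∃ c, k = 2 * a + 2 + c := ⟨k - (2 * a + 2), by omega⟩
  subst hc
  have e2 : 2 * a + 2 + c - 1 = 2 * a + 1 + c := by omega
  have e3 : 2 * a + 2 + c - a - 2 = a + c := by omega
  have e4 : 2 * a + 2 + c - 2 * a - 1 = c + 1 := by omega
  have e5 : 2 * a + 2 + c - 2 = 2 * a + c := by omega
  have e6 : 2 * a + 2 + c - a = a + 2 + c := by omega
  rw [e2] at hk''
  rw [e3] at hT
  rw [e4, e5, hsq, ← hedges'] at heq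
  rw [e6] at hm
  have hda : a ≤ d := by omega
-- `d = a`: onto the cell `(k − 1, a, 1)`
  have hda' : a = d := by omega
  subst hda'
  obtain ⟨hm1, hm2⟩ := one_within_edges a (2 * a + 2 + c) D.edgeFinset.card m' (by omega) (by omega)
    hedges' (by rw [e6]; exact hm)
  have hm'1 : (del D z).edgeFinset.card + 1 = a * (Fintype.card {v : V // v ≠ z} - a) := by
    rw [hm'def, hk'']
    have e : 2 * a + 1 + c - a = a + 1 + c := by omega
    rw [e]
    have e' : 2 * a + 2 + c - 1 - a = a + 1 + c := by omega
    rw [e'] at hm1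
    exact hm1
  by_cases hbip : ∃ A' : Finset {v : V // v ≠ z}, A'.card = a ∧ BipSub (del D z) A'
  · obtain ⟨A', hA'card, hA'⟩ := hbip
    rcases nbhd_one_side_of_bipSub D hK z A' a 1 hA'card hA' hm'1 (by omega) with hin | hoff
    · exfalso
      obtain ⟨B, hBcard, hB⟩ := bipSub_lift D z A' hA' hin
      exact hnb ⟨B, by rw [hBcard, hA'card], hB⟩
    · obtain ⟨A, hAcard, hA⟩ := bipSub_insert_of_nbhd_off D z A' hA' hoff
      exact ⟨A, by rw [hAcard, hA'card], hA⟩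
  · -- the gap case: `D − z` at the second-best value of `(k − 1, a, 1)`
    rcases below_second_order_gen (del D z) hK' a 1 ha (by norm_num) (by omega) (by rw [hk'']; omega) hm'1
      with h | hgap
    · exact absurd h hbip
    rw [hS'def, hm'def, hk''] at hgap
    have e7 : 2 * a + 1 + c - 1 - 1 = 2 * a + c - 1 := by omega
    have e8 : 2 * a + 1 + c - 2 * a - 1 = c := by omega
    rw [e7, e8, one_mul] at hgap
    obtain ⟨hS'eq, hTeq'⟩ := one_within_eq_gap a c m' S' T (by omega) (by rw [hedges']; exact hm) hgap hT heq
    have hdeg : ∀ w : {v : V // v ≠ z}, D.Adj w.1 z → deg (del D z) w = a + c :=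
      deg_del_eq_of_sum_eq D z (a + c) (fun v => by have := hcap v; omega) (by rw [hTdef, hTeq', hd])
    clear hT hTdef hTeq' heq hgap hcap hsq hne hnb
    have hm'' : (del D z).edgeFinset.card + a * a + 1 = a * Fintype.card {v : V // v ≠ z} := by
      rw [hm'def, hk'']
      have e' : 2 * a + 2 + c - 1 - a = a + 1 + c := by omega
      rw [e'] at hm1
      exact one_within_a_edges a c m' hm1
    rcases Nat.eq_zero_or_pos c with hc0 | hc1
    · -- `k = 2a + 2`: `D − z` at the first-order equality of `(2a + 1, a, 1)` is `a`-bipartite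
      exfalso
      subst hc0
      simp only [add_zero, mul_zero, zero_mul] at hS'eq hk''
      exact hbip (one_within_first_order D hK a ha z (by omega) hm'' (by
        rw [hS'def, hm'def, hk'']
        have e9 : 2 * a + 1 - 1 - 1 = 2 * a - 1 := by omega
        rw [e9]; exact hS'eq))
    · -- `k ≥ 2a + 3`: the locus at `k − 1`
      have hne' : S' + (2 * a + c - 1) ≠ m' * (2 * a + 1 + c) := by
        intro h
        exact hbip (one_within_first_order D hK a ha z (by rw [hk'']; omega) hm'' (by
          rw [hS'def, hm'def, hk'', e7]; exact h))
      have e7' : 2 * a + 1 + c - 2 = 2 * a + c - 1 := by omega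
      rcases hIH (by rw [hk'']; omega) (by rw [hS'def, hm'def, hk'', e7']; exact hne') (by
          rw [hS'def, hm'def, hk'', e7', e8]; exact hS'eq) with ⟨A'', v, hA''card, hA'', -⟩ | ⟨ha4, hk11, hhung⟩
      · exact one_within_structure D hK a c ha hc1 z hd hk'' A'' hA''card hA'' hdeg
      · -- `k = 12`, `a = 4`, `D − z` the hung `K_{5,5}`: four neighbours of degree `6` — impossible
        exfalso
        subst ha4
        have hc2 : c = 2 := by omega
        subst hc2
        have h := hungK55_card_deg_six (del D z) hk11 hhung
          (univ.filter (fun w : {v : V // v ≠ z} => D.Adj w.1 z))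
          (fun w hw => by rw [mem_filter] at hw; exact hdeg w hw.2)
        rw [card_nbhd_del, hd] at h
        omega

end C047

end TriangleCap

end PercRepro
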